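import Summits.HodgeConjecture.HodgeConjecture.Theorems.PadicSemiregularLiftHodgeFermatVarietiesStubEigenspacePham
import Summits.HodgeConjecture.HodgeConjecture.Theorems.PadicSemiregularLiftHodgeFermatVarietiesStubClaimLevelPullFacts
import Summits.HodgeConjecture.HodgeConjecture.Theorems.PadicSemiregularLiftHodgeFermatVarietiesLevelRaise
import Literature.AlgebraicGeometry.HodgeTheory.FermatEigenspaceHodgeTypes
import Literature.AlgebraicGeometry.HodgeTheory.FermatHodgeConjectureAokiProofs
import Literature.AlgebraicGeometry.HodgeTheory.ShiodaClaimPairedOfJuxtaposition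
import Literature.AlgebraicGeometry.HodgeTheory.ComplexConjugationHolds
import HarnessLib

/-!
# The eigenspace structure (E) of `H²ᵖ(X²ᵖₘ(ℂ); ℂ)` from the Hodge types of the eigenlines — line `cancel-by-any-claim-lattice`, crux `HodgeFermatVarieties` (stmt-HodgeConjecture-1334)

Helper file (`--supports stmt-HodgeConjecture-1334`) for stub S5 `stub_eigenspaceStructure` of the
skeleton of line `cancel-by-any-claim-lattice`. The stub is the conjunction (E2) ∧ (E0) ∧ (E4) of the
eigenspace inputs of the tree's Fermat assemblies (`hodgeClasses_algebraic_fermat_of_claims_at'`,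
`mem_algebraicClasses_fermat_middle_of_eigenspaces`, `Aoki1987_primePow_of_eigenspaces`), for ALL
`m ≥ 1`, `p > 0`. (E2) ∧ (E0) is the LANDED `stub_eigenspacePham` (Pham/Milnor, `…StubEigenspacePham`);
(E4) is the printed theorem Ran 1980 Prop. 1.7 (ii), `(p,p)` case, now the named fact
`Ran1980_fermatEigenspace_hodgeType_pp` (`Literature/…/FermatEigenspaceHodgeTypes`). PROVED here:

* `stub_eigenspaceStructure_of_E4` (registered, seat 2's assembly stub) — (E4) → S5, using the
  landed (E2), (E0);
* `eigenspaceStructure_of_hodgeType` — **S5 for all `(m, p)` from the one named fact**;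
* `hodgeClasses_algebraic_fermat_of_claims_at_of_hodgeType`,
  `hodgeConjectureFor_fermat_of_claims_at_of_hodgeType` — the tree's PER-DEGREE assembly
  `hodgeClasses_algebraic_fermat_of_claims_at'` with its input (E) supplied: at a degree `m ≥ 1`, HC
  for every `Xⁿₘ` follows from the Hodge-type fact and claim for every Hodge character of every `X²ᵖₘ`;
* `Aoki1987_hodgeClasses_algebraic_fermat_primePow_of_facts`,
  `hodgeConjectureFor_fermat_primePow_of_facts` — **Aoki's Cor. 2-3 (HC for every Fermat variety of
  PRIME-POWER degree, all `n`) from SEVEN PRINTED THEOREMS**: the tree's `Aoki1987_primePow_of_pStandard`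
  ((L) Lefschetz discharged; (A) Thm 1-2 proved in the tree) with (E) from the Ran fact, (G) Thm 1-4
  (i)/(ii) + Thm 1-1 (derived), (S) Thm 2-1, (F) the Fermat-surface claims from Aoki–Shioda (2.1), and
  the DEGREE-RAISING step (D) `hDeg` — implicit in "immediate consequence" and the reason da Silva
  credits Aoki with `m = p²` only — now PROVED along the landed level map `fermatLevelMap` modulo
  Fulton Cor. 19.2 (b) + Bredon II.19.2 (`stub_claimLevelPull_of_facts`, `hDeg_of_levelPull`).

## References

* [Ran1980] Z. Ran, Cycles on Fermat hypersurfaces, Compositio Math. 42 (1980), §1 Prop. 1.7.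
* [Shioda1979PJA] T. Shioda, Proc. Japan Acad. 55A (1979) 111–114, §2 Thm. 1, §4.
-/

set_option linter.dupNamespace false

noncomputable section

open CategoryTheory AlgebraicGeometry Finset
open Literature.AlgebraicGeometry Literature.AlgebraicGeometry.Motives
open Literature.AlgebraicGeometry.HodgeTheory Literature.AlgebraicGeometry.HodgeTheory.FermatCharacter
open Literature.AlgebraicTopology.SingularHomology

namespace Summit.HodgeConjecture.HodgeConjecture.Theorems.CancelByAnyClaimLattice

/-- **S5 from (E4)** (registered assembly stub of seat 2): granted the Hodge types of the zero-free
eigenlines (E4), the eigenspace structure (E2) ∧ (E0) ∧ (E4) of `H²ᵖ(X²ᵖₘ(ℂ); ℂ)` holds for every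
`m ≥ 1`, `p > 0` — (E2), (E0) being the landed `stub_eigenspacePham`.
[cite: Ran1980, §1 Prop. 1.7 (i)–(ii)] -/
theorem stub_eigenspaceStructure_of_E4 : (∀ (m : ℕ) [NeZero m] ⦃p : ℕ⦄, 0 < p → ∀ (A : HodgeModel (2 * p) (fermatHypersurface (2 * p) m)) (β : Fin (2 * p + 2) → ZMod m), (∀ i, β i ≠ 0) → (∃ x ∈ fermatEigenspace m β (2 * p), x ≠ 0 ∧ A.pullback (2 * p) x ∈ A.hodgePQ (2 * p) p p) → 2 * FermatCharacter.normSum β = m * (2 * p + 2)) → ∀ (m : ℕ) [NeZero m] ⦃p : ℕ⦄, 0 < p → (∀ α : Fin (2 * p + 2) → ZMod m, α ≠ 0 → (∃ i, α i = 0) → fermatEigenspace m α (2 * p) = ⊥) ∧ (fermatEigenspace m (0 : Fin (2 * p + 2) → ZMod m) (2 * p) ≤ LinearMap.range (complexBetti.map (SmoothHypersurface.hypersurfaceι (fermatPolynomial ℂ (2 * p) m)) (2 * p)).hom) ∧ (∀ (A : HodgeModel (2 * p) (fermatHypersurface (2 * p) m)) (β : Fin (2 * p + 2) → ZMod m), (∀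 i, β i ≠ 0) → (∃ x ∈ fermatEigenspace m β (2 * p), x ≠ 0 ∧ A.pullback (2 * p) x ∈ A.hodgePQ (2 * p) p p) → 2 * FermatCharacter.normSum β = m * (2 * p + 2)) :=
  fun hE4 m _ _ hp ↦ ⟨(stub_eigenspacePham m hp).1, (stub_eigenspacePham m hp).2, hE4 m hp⟩

/-- **The eigenspace structure S5 for all `(m, p)` from the one named fact
`Ran1980_fermatEigenspace_hodgeType_pp`** (Ran Prop. 1.7 (ii), `(p,p)` case); the rest is proved
(Pham/Milnor). [cite: Ran1980, §1 Prop. 1.7 (i)–(ii)] -/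
theorem eigenspaceStructure_of_hodgeType (hE4 : Ran1980_fermatEigenspace_hodgeType_pp) (m : ℕ) [NeZero m]
    ⦃p : ℕ⦄ (hp : 0 < p) :
    (∀ α : Fin (2 * p + 2) → ZMod m, α ≠ 0 → (∃ i, α i = 0) → fermatEigenspace m α (2 * p) = ⊥) ∧
    (fermatEigenspace m (0 : Fin (2 * p + 2) → ZMod m) (2 * p) ≤
      LinearMap.range (complexBetti.map
        (SmoothHypersurface.hypersurfaceι (fermatPolynomial ℂ (2 * p) m)) (2 * p)).hom) ∧
    (∀ (A : HodgeModel (2 * p) (fermatHypersurface (2 * p) m)) (β : Fin (2 * p + 2) → ZMod m),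
      (∀ i, β i ≠ 0) →
      (∃ x ∈ fermatEigenspace m β (2 * p), x ≠ 0 ∧ A.pullback (2 * p) x ∈ A.hodgePQ (2 * p) p p) →
        2 * FermatCharacter.normSum β = m * (2 * p + 2)) :=
  stub_eigenspaceStructure_of_E4 hE4 m hp

/-- **HC for every Fermat variety of a fixed degree `m ≥ 1` from the Hodge-type fact and the claims**:
the tree's per-degree assembly `hodgeClasses_algebraic_fermat_of_claims_at` (Lefschetz off the middle
degree is discharged, `Voisin2003_smoothHypersurface_algebraicClasses_eq_top_holds`) with its eigenspace
input (E) supplied by `eigenspaceStructure_of_hodgeType`: if every Hodge character of every `X²ᵖₘ`,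
`p > 0`, is claimed, then every rational `(p,p)`-class on every smooth projective `X` with
`IsFermatVariety n m X` is algebraic. [cite: Shioda1979PJA, §2 Thm. 1] [cite: Ran1980, §1 Prop. 1.7] -/
theorem hodgeClasses_algebraic_fermat_of_claims_at_of_hodgeType
    (hE4 : Ran1980_fermatEigenspace_hodgeType_pp) {m : ℕ} [NeZero m]
    (hB : ∀ ⦃p : ℕ⦄, 0 < p → ∀ α : Fin (2 * p + 2) → ZMod m,
      FermatCharacter.IsHodge α → FermatCharacter.Claim m p α)
    ⦃n : ℕ⦄ ⦃X : SchemeOver ℂ⦄ (hF : IsFermatVariety n m X) (hX : IsSmoothProjective n X) (p : ℕ)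
    (c : complexBetti X (2 * p)) (hc : IsRationalClass c) (hpp : IsOfHodgeType n X (2 * p) p p c) :
    c ∈ algebraicClasses X p :=
  hodgeClasses_algebraic_fermat_of_claims_at' (fun _ hp ↦ eigenspaceStructure_of_hodgeType hE4 m hp)
    hB hF hX p c hc hpp

/-- The same in the summit's spelling: **`HodgeConjectureFor n X` for every Fermat variety of degree
`m ≥ 1`, from the Hodge-type fact and claim for every Hodge character of every `X²ᵖₘ`** (the Hodge
model by `nonempty_hodgeModel_holds`). [cite: Shioda1979PJA, §2 Thm. 1] [cite: Ran1980, §1 Prop. 1.7] -/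
theorem hodgeConjectureFor_fermat_of_claims_at_of_hodgeType
    (hE4 : Ran1980_fermatEigenspace_hodgeType_pp) {m : ℕ} [NeZero m]
    (hB : ∀ ⦃p : ℕ⦄, 0 < p → ∀ α : Fin (2 * p + 2) → ZMod m,
      FermatCharacter.IsHodge α → FermatCharacter.Claim m p α)
    ⦃n : ℕ⦄ ⦃X : SchemeOver ℂ⦄ (hF : IsFermatVariety n m X) (hX : IsSmoothProjective n X) :
    HodgeConjectureFor n X :=
  ⟨nonempty_hodgeModel_holds hX, fun p c hc hpp ↦
    hodgeClasses_algebraic_fermat_of_claims_at_of_hodgeType hE4 hB hF hX p c hc hpp⟩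

/-! ### Aoki's Cor. 2-3 (prime-power degrees) from seven printed theorems -/

/-- **HC for every complex Fermat variety of prime-power degree (Aoki 1987 Cor. 2-3, the named fact
`Aoki1987_hodgeClasses_algebraic_fermat_primePow`) from seven printed theorems**: Aoki Thm 1-4 (i)
(`hJ`), Thm 1-4 (ii) (`hC`), Thm 2-1 (`hS`), Aoki–Shioda 1983 (2.1) (`hNS`, the Fermat-surface
claims (F)), Fulton Cor. 19.2 (b) (`hF`) and Bredon II.19.2 (`hB`) (through which the degree-raising
step (D) holds along the landed level map: `stub_claimLevelPull_of_facts`, `hDeg_of_levelPull`), and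
Ran Prop. 1.7 (ii) (`hE4`, the eigenspace input (E) via `eigenspaceStructure_of_hodgeType`); Lefschetz
(L) and Thm 1-2 (A) are proved in the tree, Thm 1-1 is `Shioda_claim_paired_of_juxtaposition hJ`.
[cite: Aoki1987, Cor. 2-3 (p. 388), Thm. 1-2, Thm. 1-4, Thm. 2-1] [cite: daSilva2021HodgeFermat, Thm. 2.8] -/
theorem Aoki1987_hodgeClasses_algebraic_fermat_primePow_of_facts
    (hJ : Aoki1987_claim_juxtaposition) (hC : Aoki1987_claim_of_claim_juxtaposition_paired)
    (hS : Aoki1987_claim_pStandard) (hNS : AokiShioda1983_eigenline_le_neronSeveri)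
    (hF : fulton1998_map_mem_algebraicClasses) (hB : bredon1997_quotient_cohomology_invariants)
    (hE4 : Ran1980_fermatEigenspace_hodgeType_pp) :
    Aoki1987_hodgeClasses_algebraic_fermat_primePow :=
  Aoki1987_primePow_of_pStandard Voisin2003_smoothHypersurface_algebraicClasses_eq_top_holds
    (fun _ m hm hp ↦ by
      haveI : NeZero m := ⟨hm.ne_zero⟩
      exact eigenspaceStructure_of_hodgeType hE4 m hp)
    hJ hC (Shioda_claim_paired_of_juxtaposition hJ) hS
    (hDeg_of_levelPull (stub_claimLevelPull_of_facts hF hB)) fun k σ hσ ↦ by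
      haveI : NeZero (2 ^ k) := ⟨pow_ne_zero k two_ne_zero⟩
      exact hNS (2 ^ k) σ hσ

/-- **`HodgeConjectureFor n X` for every smooth projective `X` with `IsFermatVariety n m X`, `m` a prime
power, from the same seven printed theorems** (Hodge models exist unconditionally,
`nonempty_hodgeModel_holds`). [cite: Aoki1987, Cor. 2-3 (p. 388)] -/
theorem hodgeConjectureFor_fermat_primePow_of_facts
    (hJ : Aoki1987_claim_juxtaposition) (hC : Aoki1987_claim_of_claim_juxtaposition_paired)
    (hS : Aoki1987_claim_pStandard) (hNS : AokiShioda1983_eigenline_le_neronSeveri)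
    (hF : fulton1998_map_mem_algebraicClasses) (hB : bredon1997_quotient_cohomology_invariants)
    (hE4 : Ran1980_fermatEigenspace_hodgeType_pp) {n m : ℕ} {X : SchemeOver ℂ} (hm : IsPrimePow m)
    (hFm : IsFermatVariety n m X) (hX : IsSmoothProjective n X) : HodgeConjectureFor n X :=
  hodgeConjectureFor_fermat_primePow_of
    (Aoki1987_hodgeClasses_algebraic_fermat_primePow_of_facts hJ hC hS hNS hF hB hE4)
    nonempty_hodgeModel_holds hm hFm hX

end Summit.HodgeConjecture.HodgeConjecture.Theorems.CancelByAnyClaimLattice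

end
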